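import Literature.Topology.FourManifolds.PlanarArch
import HarnessLib

/-!
# Profiles for reshaping the rebuilt attaching circle near the push-off (handle-slide programme)

Topic `Literature/Topology/FourManifolds`; fact seat `provefact-IsStrictHandleSlide.isSurgery`
(R. C. Kirby, *The Topology of 4-Manifolds*, LNM 1374 (1989), Ch. I §4; remaining content: the
named fact (S) `Literature.Topology.FourManifolds.FramedLink.IsStrictHandleSlide.slideModel`).
Elementary real-analysis profiles used to reshape the lower arch `t ↦ (χ₁ t, v t)` of the rebuilt
attaching circle (`BandCoreRebuild.lean`) inside the flat strip at the push-off: the **fast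
abscissa** `χ♯ = χ₁ + (1 - χ₁) · smoothStep t_e t_P` (crosses the strip between the parameters
`t_e < t_P` and then stays at `1`), and the **lifted rise** `U = f + c · smoothStep a' t_e`
(strictly increasing where `f` is). Everything proved, functions given by explicit formulas in
the statements; no definitions, no named facts.

* `chiSharp_contDiff`, `chiSharp_of_le`, `chiSharp_of_ge`, `chiSharp_mem_Icc`, `le_chiSharp`,
  `deriv_chiSharp_nonneg`, `deriv_chiSharp_pos`;
* `rise_contDiff`, `deriv_rise_pos`, `rise_of_le`;
* the **delay** `σ t = t - d (1 - smoothStep tP tss t)` (`delay_*`, `one_le_deriv_delay`,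
  `deriv_comp_delay_neg`: `g ∘ σ` descends where `g` does) and the **blend**
  `Y = (1 - S₂) U + S₂ (g ∘ σ)` (`blend_*`).

## References

* R. C. Kirby, *The Topology of 4-Manifolds*, LNM 1374, Springer (1989), Ch. I §4. [Kirby1989]
-/

open scoped ContDiff Topology
open Function Set

noncomputable section

namespace Literature.Topology.FourManifolds

namespace SlideProfiles

variable {χ : ℝ → ℝ} {tₑ tP : ℝ}

/-- The fast abscissa is `C^∞`. [folklore] -/
theorem chiSharp_contDiff (hχ : ContDiff ℝ ∞ χ) :
    ContDiff ℝ ∞ (fun t ↦ χ t + (1 - χ t) * smoothStep tₑ tP t) :=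
  hχ.add ((contDiff_const.sub hχ).mul (contDiff_smoothStep _ _))

/-- Before `tₑ` the fast abscissa is `χ`. [folklore] -/
theorem chiSharp_of_le (h : tₑ < tP) {t : ℝ} (ht : t ≤ tₑ) :
    χ t + (1 - χ t) * smoothStep tₑ tP t = χ t := by
  rw [smoothStep_of_le h ht, mul_zero, add_zero]

/-- After `tP` the fast abscissa is `1`. [folklore] -/
theorem chiSharp_of_ge (h : tₑ < tP) {t : ℝ} (ht : tP ≤ t) :
    χ t + (1 - χ t) * smoothStep tₑ tP t = 1 := by
  rw [smoothStep_of_ge h ht]; ring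

/-- The fast abscissa lies between `χ` and `1` (if `χ ≤ 1`). [folklore] -/
theorem le_chiSharp (hχ1 : ∀ t, χ t ≤ 1) (t : ℝ) :
    χ t ≤ χ t + (1 - χ t) * smoothStep tₑ tP t ∧ χ t + (1 - χ t) * smoothStep tₑ tP t ≤ 1 := by
  have h1 := hχ1 t
  have hs := smoothStep_mem_Icc tₑ tP t
  constructor <;> nlinarith [hs.1, hs.2]

/-- The fast abscissa lies in `[0, 1]` (if `χ` does). [folklore] -/
theorem chiSharp_mem_Icc (hχ : ∀ t, χ t ∈ Icc (0 : ℝ) 1) (t : ℝ) :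
    χ t + (1 - χ t) * smoothStep tₑ tP t ∈ Icc (0 : ℝ) 1 := by
  obtain ⟨h1, h2⟩ := le_chiSharp (fun t ↦ (hχ t).2) (tₑ := tₑ) (tP := tP) t
  exact ⟨(hχ t).1.trans h1, h2⟩

/-- The derivative of the fast abscissa. [folklore] -/
theorem hasDerivAt_chiSharp (hχ : ContDiff ℝ ∞ χ) (t : ℝ) :
    HasDerivAt (fun t ↦ χ t + (1 - χ t) * smoothStep tₑ tP t)
      (deriv χ t * (1 - smoothStep tₑ tP t) + (1 - χ t) * deriv (smoothStep tₑ tP) t) t := by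
  have hd : HasDerivAt χ (deriv χ t) t := ((hχ.differentiable (by simp)) t).hasDerivAt
  have hs : HasDerivAt (smoothStep tₑ tP) (deriv (smoothStep tₑ tP) t) t :=
    (((contDiff_smoothStep _ _).differentiable (by simp)) t).hasDerivAt
  refine (hd.add (((hasDerivAt_const t (1 : ℝ)).sub hd).mul hs)).congr_deriv ?_
  simp only [Pi.sub_apply]
  ring

/-- The fast abscissa is non-decreasing (if `χ` is and `χ ≤ 1`). [folklore] -/
theorem deriv_chiSharp_nonneg (hχ : ContDiff ℝ ∞ χ) (h : tₑ < tP) (hmono : ∀ t, 0 ≤ deriv χ t)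
    (hχ1 : ∀ t, χ t ≤ 1) (t : ℝ) :
    0 ≤ deriv (fun t ↦ χ t + (1 - χ t) * smoothStep tₑ tP t) t := by
  rw [(hasDerivAt_chiSharp hχ t).deriv]
  have h1 := hχ1 t
  have hs := smoothStep_mem_Icc tₑ tP t
  have hd := deriv_smoothStep_nonneg h t
  have hm := hmono t
  nlinarith [hs.2]

/-- The fast abscissa is strictly increasing across the strip where `χ < 1`. [folklore] -/
theorem deriv_chiSharp_pos (hχ : ContDiff ℝ ∞ χ) (h : tₑ < tP) (hmono : ∀ t, 0 ≤ deriv χ t)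
    {t : ℝ} (ht : t ∈ Ioo tₑ tP) (hlt : χ t < 1) :
    0 < deriv (fun t ↦ χ t + (1 - χ t) * smoothStep tₑ tP t) t := by
  rw [(hasDerivAt_chiSharp hχ t).deriv]
  have hs := smoothStep_mem_Icc tₑ tP t
  have hd := deriv_smoothStep_pos h ht
  have hm := hmono t
  nlinarith [hs.2, mul_pos (sub_pos.2 hlt) hd]

variable {f : ℝ → ℝ} {a' c : ℝ}

/-- The lifted rise is `C^∞`. [folklore] -/
theorem rise_contDiff (hf : ContDiff ℝ ∞ f) :
    ContDiff ℝ ∞ (fun t ↦ f t + c * smoothStep a' tₑ t) :=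
  hf.add (contDiff_const.mul (contDiff_smoothStep _ _))

/-- Before `a'` the lifted rise is `f`. [folklore] -/
theorem rise_of_le (h : a' < tₑ) {t : ℝ} (ht : t ≤ a') : f t + c * smoothStep a' tₑ t = f t := by
  rw [smoothStep_of_le h ht, mul_zero, add_zero]

/-- After `tₑ` the lifted rise is `f + c`. [folklore] -/
theorem rise_of_ge (h : a' < tₑ) {t : ℝ} (ht : tₑ ≤ t) : f t + c * smoothStep a' tₑ t = f t + c := by
  rw [smoothStep_of_ge h ht, mul_one]

/-- The lifted rise has derivative `> 0` wherever `f` does (`c ≥ 0`). [folklore] -/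
theorem deriv_rise_pos (hf : ContDiff ℝ ∞ f) (h : a' < tₑ) (hc : 0 ≤ c) {t : ℝ} (hft : 0 < deriv f t) :
    0 < deriv (fun t ↦ f t + c * smoothStep a' tₑ t) t := by
  have hd : HasDerivAt f (deriv f t) t := ((hf.differentiable (by simp)) t).hasDerivAt
  have hs : HasDerivAt (smoothStep a' tₑ) (deriv (smoothStep a' tₑ) t) t :=
    (((contDiff_smoothStep _ _).differentiable (by simp)) t).hasDerivAt
  have h3 : HasDerivAt (fun t ↦ f t + c * smoothStep a' tₑ t) (deriv f t + c * deriv (smoothStep a' tₑ) t) t :=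
    hd.add (hs.const_mul c)
  rw [h3.deriv]
  have := deriv_smoothStep_nonneg h t
  nlinarith [mul_nonneg hc this]

/-- The lifted rise lies between `f` and `f + c` (`c ≥ 0`). [folklore] -/
theorem rise_mem_Icc (hc : 0 ≤ c) (t : ℝ) : f t + c * smoothStep a' tₑ t ∈ Icc (f t) (f t + c) := by
  have hs := smoothStep_mem_Icc a' tₑ t
  constructor <;> nlinarith [hs.1, hs.2]


/-! ### The delayed descent `g ∘ σ` and the blended height profile -/

variable {g : ℝ → ℝ} {tP' tss d : ℝ}

/-- The delay reparametrisation `σ t = t - d (1 - smoothStep tP tss t)` is `C^∞`. [folklore] -/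
theorem delay_contDiff : ContDiff ℝ ∞ (fun t ↦ t - d * (1 - smoothStep tP' tss t)) :=
  contDiff_id.sub (contDiff_const.mul (contDiff_const.sub (contDiff_smoothStep _ _)))

/-- After `tss` the delay is the identity. [folklore] -/
theorem delay_of_ge (h : tP' < tss) {t : ℝ} (ht : tss ≤ t) : t - d * (1 - smoothStep tP' tss t) = t := by
  rw [smoothStep_of_ge h ht]; ring

/-- Before `tP` the delay is the shift by `-d`. [folklore] -/
theorem delay_of_le (h : tP' < tss) {t : ℝ} (ht : t ≤ tP') : t - d * (1 - smoothStep tP' tss t) = t - d := by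
  rw [smoothStep_of_le h ht]; ring

/-- The delay has derivative `≥ 1` (`d ≥ 0`). [folklore] -/
theorem hasDerivAt_delay (t : ℝ) :
    HasDerivAt (fun t ↦ t - d * (1 - smoothStep tP' tss t)) (1 + d * deriv (smoothStep tP' tss) t) t := by
  have hs : HasDerivAt (smoothStep tP' tss) (deriv (smoothStep tP' tss) t) t :=
    (((contDiff_smoothStep _ _).differentiable (by simp)) t).hasDerivAt
  refine ((hasDerivAt_id t).sub (((hasDerivAt_const t (1 : ℝ)).sub hs).const_mul d)).congr_deriv ?_
  ring

/-- The delay has derivative `≥ 1` (`d ≥ 0`). [folklore] -/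
theorem one_le_deriv_delay (h : tP' < tss) (hd : 0 ≤ d) (t : ℝ) :
    1 ≤ deriv (fun t ↦ t - d * (1 - smoothStep tP' tss t)) t := by
  rw [(hasDerivAt_delay t).deriv]
  have := deriv_smoothStep_nonneg h t
  nlinarith [mul_nonneg hd this]

/-- The delayed point lies in `[t - d, t]` (`d ≥ 0`). [folklore] -/
theorem delay_mem_Icc (hd : 0 ≤ d) (t : ℝ) : t - d * (1 - smoothStep tP' tss t) ∈ Icc (t - d) t := by
  have hs := smoothStep_mem_Icc tP' tss t
  constructor <;> nlinarith [hs.1, hs.2]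

/-- **The delayed descent `g ∘ σ` is strictly decreasing** wherever `g` is decreasing at the delayed
point: `deriv (g ∘ σ) t = g' (σ t) · σ' t < 0` if `g' (σ t) < 0` (`d ≥ 0`). [folklore] -/
theorem deriv_comp_delay_neg (hg : ContDiff ℝ ∞ g) (h : tP' < tss) (hd : 0 ≤ d) {t : ℝ}
    (hgt : deriv g (t - d * (1 - smoothStep tP' tss t)) < 0) :
    deriv (fun t ↦ g (t - d * (1 - smoothStep tP' tss t))) t < 0 := by
  have hσ := hasDerivAt_delay (tP' := tP') (tss := tss) (d := d) t
  have hgd : HasDerivAt g (deriv g (t - d * (1 - smoothStep tP' tss t))) (t - d * (1 - smoothStep tP' tss t)) :=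
    ((hg.differentiable (by simp)) _).hasDerivAt
  have hc : HasDerivAt (fun t ↦ g (t - d * (1 - smoothStep tP' tss t)))
      (deriv g (t - d * (1 - smoothStep tP' tss t)) * (1 + d * deriv (smoothStep tP' tss) t)) t := hgd.comp t hσ
  rw [hc.deriv]
  have h1 := one_le_deriv_delay h hd t
  rw [(hasDerivAt_delay t).deriv] at h1
  nlinarith

variable {U : ℝ → ℝ} {tc : ℝ}

/-- The blended height profile `Y = (1 - S₂) U + S₂ (g ∘ σ)`, `S₂ = smoothStep tc tP`, is `C^∞`.
[folklore] -/
theorem blend_contDiff (hU : ContDiff ℝ ∞ U) (hg : ContDiff ℝ ∞ g) :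
    ContDiff ℝ ∞ (fun t ↦ (1 - smoothStep tc tP' t) * U t +
      smoothStep tc tP' t * g (t - d * (1 - smoothStep tP' tss t))) :=
  ((contDiff_const.sub (contDiff_smoothStep _ _)).mul hU).add
    ((contDiff_smoothStep _ _).mul (hg.comp delay_contDiff))

/-- Before `tc` the blend is `U`. [folklore] -/
theorem blend_of_le (h : tc < tP') {t : ℝ} (ht : t ≤ tc) :
    (1 - smoothStep tc tP' t) * U t + smoothStep tc tP' t * g (t - d * (1 - smoothStep tP' tss t)) = U t := by
  rw [smoothStep_of_le h ht]; ring

/-- After `tP` the blend is the delayed descent. [folklore] -/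
theorem blend_of_ge (h : tc < tP') {t : ℝ} (ht : tP' ≤ t) :
    (1 - smoothStep tc tP' t) * U t + smoothStep tc tP' t * g (t - d * (1 - smoothStep tP' tss t)) =
      g (t - d * (1 - smoothStep tP' tss t)) := by
  rw [smoothStep_of_ge h ht]; ring

/-- After `tss` the blend is `g` itself. [folklore] -/
theorem blend_of_ge' (h : tc < tP') (h' : tP' < tss) {t : ℝ} (ht : tss ≤ t) :
    (1 - smoothStep tc tP' t) * U t + smoothStep tc tP' t * g (t - d * (1 - smoothStep tP' tss t)) = g t := by
  rw [blend_of_ge h (h'.le.trans ht), delay_of_ge h' ht]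

/-- The blend lies between the two profiles. [folklore] -/
theorem blend_mem_uIcc (t : ℝ) :
    (1 - smoothStep tc tP' t) * U t + smoothStep tc tP' t * g (t - d * (1 - smoothStep tP' tss t)) ∈
      Icc (min (U t) (g (t - d * (1 - smoothStep tP' tss t)))) (max (U t) (g (t - d * (1 - smoothStep tP' tss t)))) := by
  have hs := smoothStep_mem_Icc tc tP' t
  set x := U t
  set y := g (t - d * (1 - smoothStep tP' tss t))
  constructor
  · rcases le_total x y with hxy | hxy
    · rw [min_eq_left hxy]; nlinarith [hs.1, hs.2]
    · rw [min_eq_right hxy]; nlinarith [hs.1, hs.2]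
  · rcases le_total x y with hxy | hxy
    · rw [max_eq_right hxy]; nlinarith [hs.1, hs.2]
    · rw [max_eq_left hxy]; nlinarith [hs.1, hs.2]

end SlideProfiles

end Literature.Topology.FourManifolds
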